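import Mathlib
import Literature.NumberTheory.Automorphic.LocalWeylLaw

/-!
# Invariant integral operators on `L²(Γ\ℍ)`: bounded self-adjoint operators on `L²(F)`
(Iwaniec, *Spectral Methods of Automorphic Forms*, GSM 53, §1.8, §2.2, §4.1, §7.4;
PDF pp. 20–21, 28–29, 55–56, 76)

Nineteenth layer of the `provefact` decomposition of `Literature.NumberTheory.Automorphic.sl2BallCount_asymp`
(`HyperbolicLatticeCount.lean`), first brick of the *discrete part* of the spectral theorem for
`L²(SL₂(ℤ)\ℍ)` behind `Iwaniec2002_thm_7_4_modular` (`ModularPretrace.lean`): the invariant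
integral operators `L_k` of a continuous compactly supported point-pair invariant `k(u(z, w))`,
realised as bounded self-adjoint operators `T_k` on the Hilbert space `L²(F, dμ)` of a fundamental
domain `F` of a discrete `Γ ≤ SL₂(ℝ)` with `-1 ∈ Γ` (Iwaniec §4.1: "the invariant integral operators
... act on `L²(Γ\ℍ)` ... with the automorphic kernel `K(z, w)`"; §7.4: `(Lf)(z) = ∫_F K(z, w) f(w) dμw`).
Everything here is proved; nothing is vendored.

1. **Two-point homogeneity** `exists_sl2_swap`: some `g ∈ SL₂(ℝ)` swaps any two points of `ℍ`;
   hence the composition kernels `∫_ℍ k(u(z,v)) k'(u(v,w)) dμ(v)` are symmetric in `k, k'`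
   (`integral_kernel_mul_kernel_comm`) — the reason invariant integral operators commute (§1.8).
2. The automorphic kernel `K(z, w) = Σ_{γ ∈ Γ} k(u(γz, w))` of a continuous test kernel is jointly
   continuous (`continuous_automorphicKernel₂`, locally a finite sum), `|K_k| ≤ K_{|k|}`, and its
   Schur mass is `∫_F K_{|k|}(z, w) dμ(w) = 8π ∫_0^∞ |k|` by unfolding (`setLIntegral_automorphicKernel_abs`).
3. **The operator `(T_k g)(z) = ½ ∫_F K(z, w) g(w) dμ(w)`** (`kernelOp`; the `½` is `#{±1}`, so that
   `T_k g = L_k g` for automorphic `g`, `kernelOp_eq_invariantOperator_of_automorphic`): weighted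
   Cauchy–Schwarz and the **Schur test** give `‖T_k g‖_{L²(F)} ≤ 4π(∫|k|) ‖g‖_{L²(F)}`
   (`eLpNorm_kernelOp_le`); `K(z, ·) ∈ L²(F)` (`memLp_automorphicKernel_right`, again by unfolding);
   hence the bounded operator `kernelCLM : L²(F) →L[ℂ] L²(F)` with `‖T_k‖ ≤ C_k/2`.
4. **Self-adjointness** (`isSelfAdjoint_kernelCLM`): `⟨T_k f, g⟩ = ⟨f, T_k g⟩ = ½∬ K(z,w) f̄(w) g(z)`
   by Fubini (the double integral converges absolutely, `integrable_kernel_prod`) and `K(z,w) = K(w,z)`.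
5. **Eigenfunctions** (Theorem 1.16 on `L²(Γ\ℍ)`): `T_k u = h(t) u` for automorphic `C²` solutions of
   `(Δ + 1/4 + t²)u = 0` (`kernelOp_eigenfunction`, `kernelCLM_toLp_eigenfunction`) and
   `T_k c = h(i/2) c` on constants.
6. **The automorphic extension** `g^Γ(z) = ½ Σ_γ (𝟙_F g)(γz)` of `g ∈ L²(F)` (`autExt`): exactly
   `Γ`-invariant, `= g` a.e. on `F`, a.e.-strongly measurable, locally square integrable
   (`2∫_C |g^Γ|² ≤ N_C ∫_F |g|²` with the orbit-count bound `N_C`, `lintegral_enorm_sq_autExt_le`),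
   and `T_k g = L_k g^Γ` pointwise (`kernelOp_eq_invariantOperator`) — the bridge to the regularity
   theory of `InvariantOperatorRegularity.lean` and to the cusp estimates of the next layer.

Mathlib: `MeasureTheory.Lp` / `L2.inner_def`, `LinearMap.mkContinuous`,
`LinearMap.IsSymmetric.isSelfAdjoint`, `ENNReal.lintegral_mul_le_Lp_mul_Lq` (Hölder),
`lintegral_lintegral_swap`, `integral_integral_swap`, `AEStronglyMeasurable.integral_prod_right'`,
`aestronglyMeasurable_of_tendsto_ae`, `UpperHalfPlane.toSL2R_smul_I`, `IsIsometricSMul SL(2,ℝ) ℍ`.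
Literature: `automorphicKernel`, `finite_hypBall` (`AutomorphicKernel.lean`), unfolding
`setLIntegral_tsum_smul_eq` / `setIntegral_automorphicKernel_mul(_eigenfunction)`,
`automorphicKernel_comm`, `ae_orbit_meets_two` (`FundamentalDomainUnfolding.lean`),
`Bessel.integrable_mul` (`LocalWeylLaw.lean`), `rot`, `axisPt` (`InvariantOperatorEigenfunctions.lean`),
`invariantOperator_const` (`InvariantIntegralOperators.lean`). Neither Mathlib nor Literature had
integral operators on `L²` of a fundamental domain or the Schur test
(`lean search 'Schur test|kernelOp|integral operator.*Lp'`).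
-/

noncomputable section

open MeasureTheory Set Filter Real UpperHalfPlane
open scoped Topology MatrixGroups ComplexConjugate NNReal ENNReal

namespace Literature.NumberTheory.Automorphic

/-! ## 1. Two-point homogeneity: an isometry swapping two points -/

/-- The diagonal matrix `diag(e^{r/2}, e^{-r/2}) ∈ SL₂(ℝ)` (hyperbolic translation along the
imaginary axis by `r`). [folklore] -/
def axisDil (r : ℝ) : SL(2, ℝ) :=
  ⟨!![Real.exp (r / 2), 0; 0, Real.exp (-(r / 2))], by
    rw [Matrix.det_fin_two_of, ← Real.exp_add]; simp⟩

/-- `diag(e^{r/2}, e^{-r/2}) · (i e^s) = i e^{s + r}`. [folklore] -/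
theorem axisDil_smul_axisPt (r s : ℝ) : axisDil r • axisPt s = axisPt (s + r) := by
  apply UpperHalfPlane.ext
  rw [UpperHalfPlane.coe_specialLinearGroup_apply, coe_axisPt]
  simp [axisDil]
  rw [div_eq_iff (Complex.exp_ne_zero _), mul_assoc, mul_comm (Complex.exp _), mul_assoc,
    ← Complex.exp_add, ← Complex.exp_add]
  congr 2
  ring

/-- **Two-point homogeneity of `ℍ`**: for any `z, w ∈ ℍ` there is `g ∈ SL₂(ℝ)` with `g z = w` and
`g w = z` (the half-turn about the midpoint of the geodesic segment `[z, w]`). [folklore] -/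
theorem exists_sl2_swap (z w : ℍ) : ∃ g : SL(2, ℝ), g • z = w ∧ g • w = z := by
  -- reduce to `z = i`
  set h : SL(2, ℝ) := UpperHalfPlane.toSL2R z with hh
  set w' : ℍ := h⁻¹ • w with hw'
  obtain ⟨θ, r, hw'eq⟩ := exists_eq_rot_smul_axisPt w'
  -- `m` swaps `i` and `i e^r`
  set m : SL(2, ℝ) := axisDil r * rot (π / 2) with hm
  have hm1 : m • UpperHalfPlane.I = axisPt r := by
    rw [hm, mul_smul, rot_smul_I, ← axisPt_zero, axisDil_smul_axisPt, zero_add]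
  have hm2 : m • axisPt r = UpperHalfPlane.I := by
    rw [hm, mul_smul, rot_pi_div_two_smul_axisPt, axisDil_smul_axisPt, neg_add_cancel, axisPt_zero]
  -- `σ₀` swaps `i` and `w'`
  set σ₀ : SL(2, ℝ) := rot θ * m * (rot θ)⁻¹ with hσ₀
  have hrinv : (rot θ)⁻¹ • UpperHalfPlane.I = UpperHalfPlane.I := by
    rw [inv_smul_eq_iff, rot_smul_I]
  have h01 : σ₀ • UpperHalfPlane.I = w' := by
    rw [hσ₀, mul_smul, mul_smul, hrinv, hm1, ← hw'eq]
  have h02 : σ₀ • w' = UpperHalfPlane.I := by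
    rw [hσ₀, mul_smul, mul_smul, hw'eq, inv_smul_smul, hm2, rot_smul_I]
  refine ⟨h * σ₀ * h⁻¹, ?_, ?_⟩
  · have hz : h⁻¹ • z = UpperHalfPlane.I := by
      rw [inv_smul_eq_iff, hh, UpperHalfPlane.toSL2R_smul_I]
    rw [mul_smul, mul_smul, hz, h01, hw', smul_inv_smul]
  · rw [mul_smul, mul_smul, ← hw', h02, hh, UpperHalfPlane.toSL2R_smul_I]

/-- **Symmetry of the composition of two point-pair invariant kernels**:
`∫_ℍ k(u(z,v)) k'(u(v,w)) dμ(v) = ∫_ℍ k'(u(z,v)) k(u(v,w)) dμ(v)` (substitute `v ↦ g v` with the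
isometry `g` swapping `z` and `w`). This is why invariant integral operators commute
(Iwaniec §1.8: "the invariant integral operators ... commute with each other").
[cite: Iwaniec2002, §1.8, PDF pp. 20–21] -/
theorem integral_kernel_mul_kernel_comm (k k' : ℝ → ℝ) (z w : ℍ) :
    ∫ v : ℍ, k (pointPairInv z v) * k' (pointPairInv v w) =
      ∫ v : ℍ, k' (pointPairInv z v) * k (pointPairInv v w) := by
  obtain ⟨g, hgz, hgw⟩ := exists_sl2_swap z w
  have e := (integral_smul_eq_self (μ := (volume : Measure ℍ))
    (fun v : ℍ => k (pointPairInv z v) * k' (pointPairInv v w))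
    (g := (Matrix.SpecialLinearGroup.toGL g : GL (Fin 2) ℝ))).symm
  rw [e]
  congr 1 with v
  have e1 : (Matrix.SpecialLinearGroup.toGL g : GL (Fin 2) ℝ) • v = g • v := rfl
  rw [e1]
  have h1 : pointPairInv z (g • v) = pointPairInv w v := by
    conv_lhs => rw [← hgw]
    exact pointPairInv_smul g w v
  have h2 : pointPairInv (g • v) w = pointPairInv v z := by
    conv_lhs => rw [← hgz]
    exact pointPairInv_smul g v z
  rw [h1, h2, pointPairInv_comm w v, pointPairInv_comm v z, mul_comm]

/-! ## 2. The automorphic kernel of a continuous test kernel: continuity and bounds -/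

section KernelBounds

variable {Γ : Subgroup (GL (Fin 2) ℝ)} {F : Set ℍ} {k : ℝ → ℝ}

/-- `u(f(x), g(x))` is continuous for continuous `f, g`. [folklore] -/
theorem continuous_pointPairInv_comp {X : Type*} [TopologicalSpace X] {f g : X → ℍ} (hf : Continuous f)
    (hg : Continuous g) : Continuous fun x => pointPairInv (f x) (g x) := by
  unfold pointPairInv
  refine Continuous.div ?_ ?_ ?_
  · exact ((UpperHalfPlane.continuous_coe.comp hf).dist (UpperHalfPlane.continuous_coe.comp hg)).pow 2
  · exact (continuous_const.mul (UpperHalfPlane.continuous_im.comp hf)).mul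
      (UpperHalfPlane.continuous_im.comp hg)
  · intro x
    have h1 := (f x).im_pos
    have h2 := (g x).im_pos
    positivity

/-- `u(z, w)` is jointly continuous. [folklore] -/
theorem continuous_pointPairInv₂ : Continuous fun p : ℍ × ℍ => pointPairInv p.1 p.2 :=
  continuous_pointPairInv_comp continuous_fst continuous_snd

/-- For discrete `Γ ≤ SL₂(ℝ)` the set `{γ ∈ Γ : ρ(γ z, w) ≤ R}` is finite. [cite: Iwaniec2002, §2.1, PDF pp. 27–28] -/
theorem finite_dist_le (hΓ : Γ ≤ (Matrix.SpecialLinearGroup.toGL : SL(2, ℝ) →* GL (Fin 2) ℝ).range)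
    (hd : IsDiscreteSubgroup Γ) (z w : ℍ) (R : ℝ) :
    {γ : GL (Fin 2) ℝ | γ ∈ Γ ∧ dist (γ • z) w ≤ R}.Finite :=
  (finite_hypBall hΓ hd z w (Real.sinh (R / 2) ^ 2)).subset fun _ hγ =>
    ⟨hγ.1, pointPairInv_le_of_dist_le hγ.2⟩

/-- Near any `(z₀, w₀)` the automorphic kernel of a compactly supported `k` is a fixed finite sum:
for `ρ(z, z₀) < 1`, `ρ(w, w₀) < 1`, `K(z, w) = Σ_{γ ∈ S} k(u(γ z, w))` with
`S = {γ : ρ(γ z₀, w₀) ≤ R + 2}`, `R = 2 arsinh √M`. [folklore] -/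
theorem automorphicKernel_eq_sum_near (hΓ : Γ ≤ (Matrix.SpecialLinearGroup.toGL : SL(2, ℝ) →* GL (Fin 2) ℝ).range)
    (hd : IsDiscreteSubgroup Γ) {M : ℝ} (hM : ∀ u, M ≤ u → k u = 0) (z₀ w₀ : ℍ) {z w : ℍ}
    (hz : dist z z₀ < 1) (hw : dist w w₀ < 1) :
    automorphicKernel Γ k z w =
      ∑ γ ∈ (finite_dist_le hΓ hd z₀ w₀ (2 * Real.arsinh (Real.sqrt M) + 2)).toFinset,
        k (pointPairInv (γ • z) w) := by
  apply automorphicKernel_eq_sum hM z w _ (fun γ hγ => hγ.1)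
  intro γ hγ hlt
  refine ⟨hγ, ?_⟩
  have h1 : dist (γ • z) w ≤ 2 * Real.arsinh (Real.sqrt M) := dist_le_of_pointPairInv_le hlt.le
  obtain ⟨g, rfl⟩ := hΓ hγ
  have e : ∀ x : ℍ, (Matrix.SpecialLinearGroup.toGL g : GL (Fin 2) ℝ) • x = g • x := fun x => rfl
  rw [e] at h1 ⊢
  rw [dist_comm] at hz
  calc dist (g • z₀) w₀ ≤ dist (g • z₀) (g • z) + dist (g • z) w₀ := dist_triangle _ _ _
    _ ≤ dist (g • z₀) (g • z) + (dist (g • z) w + dist w w₀) := by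
        gcongr; exact dist_triangle _ _ _
    _ = dist z₀ z + dist (g • z) w + dist w w₀ := by rw [dist_smul]; ring
    _ ≤ 2 * Real.arsinh (Real.sqrt M) + 2 := by linarith

/-- **Continuity of the automorphic kernel**: for a continuous compactly supported `k` and discrete
`Γ ≤ SL₂(ℝ)`, `(z, w) ↦ K(z, w)` is continuous on `ℍ × ℍ` (locally a finite sum). [folklore] -/
theorem continuous_automorphicKernel₂ (hΓ : Γ ≤ (Matrix.SpecialLinearGroup.toGL : SL(2, ℝ) →* GL (Fin 2) ℝ).range)
    (hd : IsDiscreteSubgroup Γ) (hk : IsTestKernel k) (hkc : Continuous k) :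
    Continuous fun p : ℍ × ℍ => automorphicKernel Γ k p.1 p.2 := by
  obtain ⟨_, _, ⟨M, _, hM⟩⟩ := hk
  rw [continuous_iff_continuousAt]
  rintro ⟨z₀, w₀⟩
  set S := (finite_dist_le hΓ hd z₀ w₀ (2 * Real.arsinh (Real.sqrt M) + 2)).toFinset with hS
  have hcont : Continuous fun p : ℍ × ℍ => ∑ γ ∈ S, k (pointPairInv (γ • p.1) p.2) := by
    refine continuous_finsetSum _ fun γ _ => hkc.comp ?_
    exact continuous_pointPairInv_comp ((continuous_const_smul γ).comp continuous_fst) continuous_snd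
  refine hcont.continuousAt.congr ?_
  have hn : ∀ᶠ p : ℍ × ℍ in 𝓝 (z₀, w₀), dist p.1 z₀ < 1 ∧ dist p.2 w₀ < 1 := by
    have : Metric.ball z₀ 1 ×ˢ Metric.ball w₀ 1 ∈ 𝓝 (z₀, w₀) :=
      prod_mem_nhds (Metric.ball_mem_nhds _ one_pos) (Metric.ball_mem_nhds _ one_pos)
    filter_upwards [this] with p hp
    exact ⟨hp.1, hp.2⟩
  filter_upwards [hn] with p hp
  exact (automorphicKernel_eq_sum_near hΓ hd hM z₀ w₀ hp.1 hp.2).symm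

/-- Continuity of `K(z, ·)`. [folklore] -/
theorem continuous_automorphicKernel_right (hΓ : Γ ≤ (Matrix.SpecialLinearGroup.toGL : SL(2, ℝ) →* GL (Fin 2) ℝ).range)
    (hd : IsDiscreteSubgroup Γ) (hk : IsTestKernel k) (hkc : Continuous k) (z : ℍ) :
    Continuous fun w : ℍ => automorphicKernel Γ k z w :=
  (continuous_automorphicKernel₂ hΓ hd hk hkc).comp₂ continuous_const continuous_id

/-- Continuity of `K(·, w)`. [folklore] -/
theorem continuous_automorphicKernel_left (hΓ : Γ ≤ (Matrix.SpecialLinearGroup.toGL : SL(2, ℝ) →* GL (Fin 2) ℝ).range)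
    (hd : IsDiscreteSubgroup Γ) (hk : IsTestKernel k) (hkc : Continuous k) (w : ℍ) :
    Continuous fun z : ℍ => automorphicKernel Γ k z w :=
  (continuous_automorphicKernel₂ hΓ hd hk hkc).comp₂ continuous_id continuous_const

/-- The absolute kernel `|k|` is again a test kernel. [folklore] -/
theorem IsTestKernel.abs (hk : IsTestKernel k) : IsTestKernel fun u => |k u| := by
  obtain ⟨hm, ⟨B, hB⟩, ⟨M, hM0, hM⟩⟩ := hk
  exact ⟨continuous_abs.measurable.comp hm, ⟨B, fun u => by rw [abs_abs]; exact hB u⟩,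
    ⟨M, hM0, fun u hu => by rw [hM u hu, abs_zero]⟩⟩

/-- `|K_k(z, w)| ≤ K_{|k|}(z, w)`. [folklore] -/
theorem abs_automorphicKernel_le (hΓ : Γ ≤ (Matrix.SpecialLinearGroup.toGL : SL(2, ℝ) →* GL (Fin 2) ℝ).range)
    (hd : IsDiscreteSubgroup Γ) (hk : IsTestKernel k) (z w : ℍ) :
    |automorphicKernel Γ k z w| ≤ automorphicKernel Γ (fun u => |k u|) z w := by
  obtain ⟨_, _, ⟨M, _, hM⟩⟩ := hk
  have hM' : ∀ u, M ≤ u → (fun u => |k u|) u = 0 := fun u hu => by simp [hM u hu]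
  have hS := finite_hypBall hΓ hd z w M
  rw [automorphicKernel_eq_sum hM z w hS (fun γ hγ => hγ.1) (fun γ hγ hlt => ⟨hγ, hlt.le⟩),
    automorphicKernel_eq_sum hM' z w hS (fun γ hγ => hγ.1) (fun γ hγ hlt => ⟨hγ, hlt.le⟩)]
  exact Finset.abs_sum_le_sum_abs _ _

/-- `0 ≤ K_{|k|}(z, w)`. [folklore] -/
theorem automorphicKernel_abs_nonneg (hΓ : Γ ≤ (Matrix.SpecialLinearGroup.toGL : SL(2, ℝ) →* GL (Fin 2) ℝ).range)
    (hd : IsDiscreteSubgroup Γ) (hk : IsTestKernel k) (z w : ℍ) :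
    0 ≤ automorphicKernel Γ (fun u => |k u|) z w :=
  (abs_nonneg _).trans (abs_automorphicKernel_le hΓ hd hk z w)

variable (hΓ : Γ ≤ (Matrix.SpecialLinearGroup.toGL : SL(2, ℝ) →* GL (Fin 2) ℝ).range)
  (hneg : (-1 : GL (Fin 2) ℝ) ∈ Γ) (hd : IsDiscreteSubgroup Γ) (hF : IsHypFundamentalDomain Γ F)
include hΓ hneg hd hF

/-- **Schur mass of the automorphic kernel** (unfolding):
`∫_F K_{|k|}(z, w) dμ(w) = 2 ∫_ℍ |k|(u(z, w)) dμ(w) = 8π ∫_0^∞ |k|`, as a Lebesgue integral.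
[cite: Iwaniec2002, §2.2 (unfolding) & §7.2, PDF pp. 28–29, 73] -/
theorem setLIntegral_automorphicKernel_abs (hk : IsTestKernel k) (z : ℍ) :
    ∫⁻ w in F, ENNReal.ofReal (automorphicKernel Γ (fun u => |k u|) z w) =
      ENNReal.ofReal (8 * π * ∫ u in Ioi 0, |k u|) := by
  obtain ⟨hkm, ⟨B, hB⟩, ⟨M, hM0, hM⟩⟩ := id hk
  have hk' : IsTestKernel (fun u => |k u|) := hk.abs
  have hM' : ∀ u, M ≤ u → (fun u => |k u|) u = 0 := fun u hu => by simp [hM u hu]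
  set φ : ℍ → ℝ≥0∞ := fun w => ENNReal.ofReal (|k (pointPairInv z w)|) with hφ
  have hφm : AEMeasurable φ :=
    (ENNReal.measurable_ofReal.comp (continuous_abs.measurable.comp
      (hkm.comp (continuous_pointPairInv z).measurable))).aemeasurable
  have h := setLIntegral_tsum_smul_eq hΓ hneg hd.countable hF hφm
  have e1 : ∀ w : ℍ, ∑' γ : Γ, φ ((γ : GL (Fin 2) ℝ) • w) =
      ENNReal.ofReal (automorphicKernel Γ (fun u => |k u|) z w) := by
    intro w
    simp only [hφ]
    rw [← ENNReal.ofReal_tsum_of_nonneg (fun γ => abs_nonneg _) ?_,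
      tsum_kernel_smul_eq_automorphicKernel hΓ hd hM' z w]
    -- summable: finite support
    apply summable_of_hasFiniteSupport
    have hfin := finite_hypBall hΓ hd w z M
    refine (hfin.preimage Subtype.val_injective.injOn).subset ?_
    intro γ hγ
    simp only [Function.mem_support, ne_eq, abs_eq_zero] at hγ
    refine ⟨γ.2, ?_⟩
    by_contra hlt
    rw [not_le] at hlt
    exact hγ (hM _ (by rw [pointPairInv_comm]; exact hlt.le))
  have e2 : ∫⁻ w in F, ∑' γ : Γ, φ ((γ : GL (Fin 2) ℝ) • w) =
      ∫⁻ w in F, ENNReal.ofReal (automorphicKernel Γ (fun u => |k u|) z w) :=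
    lintegral_congr fun w => e1 w
  rw [← e2, h]
  -- the right-hand side: `2 ∫_ℍ |k|(u(z, w)) dμ(w) = 2 · 4π ∫ |k|`
  have hint : Integrable (fun w : ℍ => |k (pointPairInv z w)|) := by
    have := (integrable_kernel_mul hk' (locallyIntegrable_const (1 : ℂ)) z).norm
    refine this.congr (Eventually.of_forall fun w => ?_)
    simp
  have e3 : ∫⁻ w, φ w = ENNReal.ofReal (∫ w : ℍ, |k (pointPairInv z w)|) := by
    rw [ofReal_integral_eq_lintegral_ofReal hint (Eventually.of_forall fun w => abs_nonneg _)]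
  rw [e3, integral_kernel_eq_real hk' z, show (8 : ℝ) * π * ∫ u in Ioi 0, |k u| =
    2 * (4 * π * ∫ u in Ioi 0, |k u|) by ring, ENNReal.ofReal_mul (by norm_num : (0 : ℝ) ≤ 2),
    ENNReal.ofReal_ofNat]

/-- The Schur mass as a constant: `C_k = 8π ∫_0^∞ |k|`. [folklore] -/
def schurConst (k : ℝ → ℝ) : ℝ := 8 * π * ∫ u in Ioi 0, |k u|

omit hΓ hneg hd hF in
/-- `C_k ≥ 0`. [folklore] -/
theorem schurConst_nonneg (k : ℝ → ℝ) : 0 ≤ schurConst k := by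
  unfold schurConst
  have : 0 ≤ ∫ u in Ioi 0, |k u| := integral_nonneg fun u => abs_nonneg _
  positivity

/-- Row bound: `∫_F |K(z, w)| dμ(w) ≤ C_k` (Lebesgue integral of `‖K‖ₑ`). [cite: Iwaniec2002, §7.2, PDF p. 73] -/
theorem setLIntegral_enorm_automorphicKernel_le (hk : IsTestKernel k) (z : ℍ) :
    ∫⁻ w in F, ‖(automorphicKernel Γ k z w : ℂ)‖ₑ ≤ ENNReal.ofReal (schurConst k) := by
  rw [schurConst, ← setLIntegral_automorphicKernel_abs hΓ hneg hd hF hk z]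
  refine lintegral_mono fun w => ?_
  rw [← ofReal_norm, Complex.norm_real, Real.norm_eq_abs]
  exact ENNReal.ofReal_le_ofReal (abs_automorphicKernel_le hΓ hd hk z w)

/-- Column bound: `∫_F |K(z, w)| dμ(z) ≤ C_k` (by the symmetry `K(z, w) = K(w, z)`). [cite: Iwaniec2002, §7.2, PDF p. 73] -/
theorem setLIntegral_enorm_automorphicKernel_le' (hk : IsTestKernel k) (w : ℍ) :
    ∫⁻ z in F, ‖(automorphicKernel Γ k z w : ℂ)‖ₑ ≤ ENNReal.ofReal (schurConst k) := by
  obtain ⟨_, _, ⟨M, _, hM⟩⟩ := id hk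
  have e : ∀ z, automorphicKernel Γ k z w = automorphicKernel Γ k w z := fun z =>
    automorphicKernel_comm hΓ hd hM z w
  simp_rw [e]
  exact setLIntegral_enorm_automorphicKernel_le hΓ hneg hd hF hk w

end KernelBounds


/-! ## 3. The integral operator `(T_k g)(z) = ½ ∫_F K(z, w) g(w) dμ(w)` on `L²(F)` -/

section CauchySchwarz

variable {X : Type*} [MeasurableSpace X]

/-- Weighted Cauchy–Schwarz: `(∫ p q)² ≤ (∫ p)(∫ p q²)` for `p, q ≥ 0` (Lebesgue integrals). [folklore] -/
theorem lintegral_mul_sq_le (μ : Measure X) {p q : X → ℝ≥0∞} (hp : AEMeasurable p μ)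
    (hq : AEMeasurable q μ) :
    (∫⁻ x, p x * q x ∂μ) ^ 2 ≤ (∫⁻ x, p x ∂μ) * ∫⁻ x, p x * q x ^ 2 ∂μ := by
  set f : X → ℝ≥0∞ := fun x => p x ^ (1 / 2 : ℝ) with hf
  set g : X → ℝ≥0∞ := fun x => p x ^ (1 / 2 : ℝ) * q x with hg
  have hfm : AEMeasurable f μ := hp.pow_const _
  have hgm : AEMeasurable g μ := (hp.pow_const _).mul hq
  have h := ENNReal.lintegral_mul_le_Lp_mul_Lq μ Real.HolderConjugate.two_two hfm hgm
  have hhalf : ∀ x : ℝ≥0∞, x ^ (1 / 2 : ℝ) * x ^ (1 / 2 : ℝ) = x := by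
    intro x
    rw [← ENNReal.rpow_add_of_nonneg _ _ (by norm_num) (by norm_num)]
    norm_num
  have hsq : ∀ x : ℝ≥0∞, (x ^ (1 / 2 : ℝ)) ^ (2 : ℝ) = x := by
    intro x
    rw [← ENNReal.rpow_mul]
    norm_num
  have efg : (f * g) = fun x => p x * q x := by
    funext x
    simp only [Pi.mul_apply, hf, hg]
    rw [← mul_assoc, hhalf]
  have ef : (fun x => f x ^ (2 : ℝ)) = p := by
    funext x; exact hsq _
  have eg : (fun x => g x ^ (2 : ℝ)) = fun x => p x * q x ^ 2 := by
    funext x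
    simp only [hg]
    rw [ENNReal.mul_rpow_of_nonneg _ _ (by norm_num), hsq, ENNReal.rpow_two]
  rw [efg, ef, eg] at h
  calc (∫⁻ x, p x * q x ∂μ) ^ 2
      ≤ ((∫⁻ x, p x ∂μ) ^ (1 / (2 : ℝ)) * (∫⁻ x, p x * q x ^ 2 ∂μ) ^ (1 / (2 : ℝ))) ^ 2 := by
        gcongr
    _ = (∫⁻ x, p x ∂μ) * ∫⁻ x, p x * q x ^ 2 ∂μ := by
        rw [mul_pow, ← ENNReal.rpow_two, ← ENNReal.rpow_two, hsq, hsq]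

end CauchySchwarz

section Operator

variable {Γ : Subgroup (GL (Fin 2) ℝ)} {F : Set ℍ} {k : ℝ → ℝ}

/-- The raw integral `∫_F K(z, w) g(w) dμ(w)`. [folklore] -/
def rawKernelOp (Γ : Subgroup (GL (Fin 2) ℝ)) (F : Set ℍ) (k : ℝ → ℝ) (g : ℍ → ℂ) (z : ℍ) : ℂ :=
  ∫ w in F, (automorphicKernel Γ k z w : ℂ) * g w

/-- **The invariant integral operator on `Γ\ℍ` realised on the fundamental domain**:
`(T_k g)(z) = ½ ∫_F K(z, w) g(w) dμ(w)` for `g : F → ℂ` (extended by anything off `F`), where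
`K(z, w) = Σ_{γ ∈ Γ} k(u(γz, w))` is the automorphic kernel over matrices (the `½` compensates
`±1`). For automorphic `g` this is `(L_k g)(z) = ∫_ℍ k(u(z,w)) g(w) dμ(w)` (unfolding,
`kernelOp_eq_invariantOperator`); Iwaniec §4.? / §7.4 writes `(Lf)(z) = ∫_F K(z, w) f(w) dμ w`.
[cite: Iwaniec2002, §1.8 & §7.4, PDF pp. 20–21, 76] -/
def kernelOp (Γ : Subgroup (GL (Fin 2) ℝ)) (F : Set ℍ) (k : ℝ → ℝ) (g : ℍ → ℂ) (z : ℍ) : ℂ :=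
  (1 / 2 : ℂ) * rawKernelOp Γ F k g z

/-- Unfolding the definition. [folklore] -/
theorem kernelOp_apply (g : ℍ → ℂ) (z : ℍ) :
    kernelOp Γ F k g z = (1 / 2 : ℂ) * ∫ w in F, (automorphicKernel Γ k z w : ℂ) * g w := rfl

/-- The integrand `(z, w) ↦ K(z, w) g(w)` is a.e.-strongly measurable on `F × F`. [folklore] -/
theorem aestronglyMeasurable_kernel_mul (hΓ : Γ ≤ (Matrix.SpecialLinearGroup.toGL : SL(2, ℝ) →* GL (Fin 2) ℝ).range)
    (hd : IsDiscreteSubgroup Γ) (hk : IsTestKernel k) (hkc : Continuous k) {g : ℍ → ℂ}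
    (hg : AEStronglyMeasurable g (volume.restrict F)) :
    AEStronglyMeasurable (fun p : ℍ × ℍ => (automorphicKernel Γ k p.1 p.2 : ℂ) * g p.2)
      ((volume.restrict F).prod (volume.restrict F)) := by
  have h1 : AEStronglyMeasurable (fun p : ℍ × ℍ => (automorphicKernel Γ k p.1 p.2 : ℂ))
      ((volume.restrict F).prod (volume.restrict F)) :=
    (Complex.continuous_ofReal.comp (continuous_automorphicKernel₂ hΓ hd hk hkc)).aestronglyMeasurable
  exact h1.mul hg.comp_snd

/-- `z ↦ ∫_F K(z, w) g(w) dμ(w)` is a.e.-strongly measurable on `F`. [folklore] -/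
theorem aestronglyMeasurable_rawKernelOp (hΓ : Γ ≤ (Matrix.SpecialLinearGroup.toGL : SL(2, ℝ) →* GL (Fin 2) ℝ).range)
    (hd : IsDiscreteSubgroup Γ) (hk : IsTestKernel k) (hkc : Continuous k) {g : ℍ → ℂ}
    (hg : AEStronglyMeasurable g (volume.restrict F)) :
    AEStronglyMeasurable (rawKernelOp Γ F k g) (volume.restrict F) :=
  (aestronglyMeasurable_kernel_mul hΓ hd hk hkc hg).integral_prod_right'

variable (hΓ : Γ ≤ (Matrix.SpecialLinearGroup.toGL : SL(2, ℝ) →* GL (Fin 2) ℝ).range)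
  (hneg : (-1 : GL (Fin 2) ℝ) ∈ Γ) (hd : IsDiscreteSubgroup Γ) (hF : IsHypFundamentalDomain Γ F)
include hΓ hneg hd hF

/-- **Schur test, pointwise**: `‖∫_F K(z,w) g(w)‖² ≤ C_k ∫_F |K(z,w)| |g(w)|² dμ(w)`.
[cite: Iwaniec2002, §1.8, PDF pp. 20–21] -/
theorem enorm_rawKernelOp_sq_le (hk : IsTestKernel k) (hkc : Continuous k) {g : ℍ → ℂ}
    (hg : AEStronglyMeasurable g (volume.restrict F)) (z : ℍ) :
    ‖rawKernelOp Γ F k g z‖ₑ ^ 2 ≤ ENNReal.ofReal (schurConst k) *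
      ∫⁻ w in F, ‖(automorphicKernel Γ k z w : ℂ)‖ₑ * ‖g w‖ₑ ^ 2 := by
  have hp : AEMeasurable (fun w => ‖(automorphicKernel Γ k z w : ℂ)‖ₑ) (volume.restrict F) :=
    (Complex.continuous_ofReal.comp (continuous_automorphicKernel_right hΓ hd hk hkc z)).measurable.enorm.aemeasurable
  have hq : AEMeasurable (fun w => ‖g w‖ₑ) (volume.restrict F) := hg.enorm
  have h1 : ‖rawKernelOp Γ F k g z‖ₑ ≤ ∫⁻ w in F, ‖(automorphicKernel Γ k z w : ℂ)‖ₑ * ‖g w‖ₑ := by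
    refine (enorm_integral_le_lintegral_enorm _).trans (le_of_eq ?_)
    congr 1 with w
    rw [enorm_mul]
  calc ‖rawKernelOp Γ F k g z‖ₑ ^ 2
      ≤ (∫⁻ w in F, ‖(automorphicKernel Γ k z w : ℂ)‖ₑ * ‖g w‖ₑ) ^ 2 := by gcongr
    _ ≤ (∫⁻ w in F, ‖(automorphicKernel Γ k z w : ℂ)‖ₑ) *
          ∫⁻ w in F, ‖(automorphicKernel Γ k z w : ℂ)‖ₑ * ‖g w‖ₑ ^ 2 :=
        lintegral_mul_sq_le _ hp hq
    _ ≤ ENNReal.ofReal (schurConst k) * ∫⁻ w in F, ‖(automorphicKernel Γ k z w : ℂ)‖ₑ * ‖g w‖ₑ ^ 2 := by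
        gcongr
        exact setLIntegral_enorm_automorphicKernel_le hΓ hneg hd hF hk z

/-- **Schur test, integrated**: `∫_F ‖∫_F K(z,w) g(w) dμ(w)‖² dμ(z) ≤ C_k² ∫_F |g|²`.
[cite: Iwaniec2002, §1.8, PDF pp. 20–21] -/
theorem lintegral_enorm_rawKernelOp_sq_le (hk : IsTestKernel k) (hkc : Continuous k) {g : ℍ → ℂ}
    (hg : AEStronglyMeasurable g (volume.restrict F)) :
    ∫⁻ z in F, ‖rawKernelOp Γ F k g z‖ₑ ^ 2 ≤
      ENNReal.ofReal (schurConst k) ^ 2 * ∫⁻ w in F, ‖g w‖ₑ ^ 2 := by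
  set P : ℍ → ℍ → ℝ≥0∞ := fun z w => ‖(automorphicKernel Γ k z w : ℂ)‖ₑ * ‖g w‖ₑ ^ 2 with hP
  have hPm : AEMeasurable (Function.uncurry P) ((volume.restrict F).prod (volume.restrict F)) := by
    have h1 : Measurable fun p : ℍ × ℍ => ‖(automorphicKernel Γ k p.1 p.2 : ℂ)‖ₑ :=
      (Complex.continuous_ofReal.comp (continuous_automorphicKernel₂ hΓ hd hk hkc)).measurable.enorm
    have h2 : AEMeasurable (fun p : ℍ × ℍ => ‖g p.2‖ₑ ^ 2) ((volume.restrict F).prod (volume.restrict F)) :=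
      (hg.comp_snd.enorm).pow_const 2
    exact h1.aemeasurable.mul h2
  calc ∫⁻ z in F, ‖rawKernelOp Γ F k g z‖ₑ ^ 2
      ≤ ∫⁻ z in F, ENNReal.ofReal (schurConst k) * ∫⁻ w in F, P z w :=
        lintegral_mono fun z => enorm_rawKernelOp_sq_le hΓ hneg hd hF hk hkc hg z
    _ = ENNReal.ofReal (schurConst k) * ∫⁻ w in F, ∫⁻ z in F, P z w := by
        rw [lintegral_const_mul' _ _ ENNReal.ofReal_ne_top, lintegral_lintegral_swap hPm]
    _ = ENNReal.ofReal (schurConst k) *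
          ∫⁻ w in F, ‖g w‖ₑ ^ 2 * ∫⁻ z in F, ‖(automorphicKernel Γ k z w : ℂ)‖ₑ := by
        congr 1
        refine lintegral_congr fun w => ?_
        have hm : AEMeasurable (fun z => ‖(automorphicKernel Γ k z w : ℂ)‖ₑ) (volume.restrict F) :=
          (Complex.continuous_ofReal.comp
            (continuous_automorphicKernel_left hΓ hd hk hkc w)).measurable.enorm.aemeasurable
        rw [← lintegral_const_mul'' _ hm]
        refine lintegral_congr fun z => ?_
        simp only [hP]
        ring
    _ ≤ ENNReal.ofReal (schurConst k) * ∫⁻ w in F, ‖g w‖ₑ ^ 2 * ENNReal.ofReal (schurConst k) := by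
        gcongr with w
        exact setLIntegral_enorm_automorphicKernel_le' hΓ hneg hd hF hk w
    _ = ENNReal.ofReal (schurConst k) ^ 2 * ∫⁻ w in F, ‖g w‖ₑ ^ 2 := by
        rw [lintegral_mul_const' _ _ ENNReal.ofReal_ne_top]
        ring

/-- `‖T_k g‖_{L²(F)} ≤ (C_k/2) ‖g‖_{L²(F)}` in terms of `eLpNorm`. [cite: Iwaniec2002, §1.8, PDF pp. 20–21] -/
theorem eLpNorm_kernelOp_le (hk : IsTestKernel k) (hkc : Continuous k) {g : ℍ → ℂ}
    (hg : AEStronglyMeasurable g (volume.restrict F)) :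
    eLpNorm (kernelOp Γ F k g) 2 (volume.restrict F) ≤
      ENNReal.ofReal (schurConst k / 2) * eLpNorm g 2 (volume.restrict F) := by
  have two_ne_zero' : (2 : ℝ≥0∞) ≠ 0 := by norm_num
  rw [eLpNorm_eq_lintegral_rpow_enorm_toReal two_ne_zero' ENNReal.ofNat_ne_top,
    eLpNorm_eq_lintegral_rpow_enorm_toReal two_ne_zero' ENNReal.ofNat_ne_top]
  simp only [ENNReal.toReal_ofNat, ENNReal.rpow_two, one_div]
  have hsq : ∀ x : ℝ≥0∞, (x ^ (2 : ℝ)⁻¹) ^ 2 = x := by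
    intro x
    rw [← ENNReal.rpow_two, ← ENNReal.rpow_mul]
    norm_num
  have e : ∀ z, ‖kernelOp Γ F k g z‖ₑ ^ 2 = (2 : ℝ≥0∞)⁻¹ ^ 2 * ‖rawKernelOp Γ F k g z‖ₑ ^ 2 := by
    intro z
    rw [kernelOp, enorm_mul, mul_pow]
    congr 2
    rw [show (1 / 2 : ℂ) = ((2⁻¹ : ℝ≥0) : ℂ) by push_cast; norm_num, enorm_eq_nnnorm]
    simp
  simp_rw [e]
  rw [lintegral_const_mul' _ _ (by simp)]
  have h := lintegral_enorm_rawKernelOp_sq_le hΓ hneg hd hF hk hkc hg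
  rw [← ENNReal.rpow_le_rpow_iff (z := 2) (by norm_num), ENNReal.rpow_two, ENNReal.rpow_two, hsq, mul_pow, hsq]
  calc (2 : ℝ≥0∞)⁻¹ ^ 2 * ∫⁻ z in F, ‖rawKernelOp Γ F k g z‖ₑ ^ 2
      ≤ (2 : ℝ≥0∞)⁻¹ ^ 2 * (ENNReal.ofReal (schurConst k) ^ 2 * ∫⁻ w in F, ‖g w‖ₑ ^ 2) := by gcongr
    _ = ENNReal.ofReal (schurConst k / 2) ^ 2 * ∫⁻ w in F, ‖g w‖ₑ ^ 2 := by
        rw [ENNReal.ofReal_div_of_pos (by norm_num : (0:ℝ) < 2), ENNReal.ofReal_ofNat, div_eq_mul_inv]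
        ring

/-- `T_k` maps `L²(F)` to `L²(F)`. [cite: Iwaniec2002, §1.8, PDF pp. 20–21] -/
theorem memLp_kernelOp (hk : IsTestKernel k) (hkc : Continuous k) {g : ℍ → ℂ}
    (hg : MemLp g 2 (volume.restrict F)) : MemLp (kernelOp Γ F k g) 2 (volume.restrict F) := by
  refine ⟨?_, ?_⟩
  · exact ((aestronglyMeasurable_rawKernelOp hΓ hd hk hkc hg.1).const_mul (1 / 2 : ℂ))
  · refine lt_of_le_of_lt (eLpNorm_kernelOp_le hΓ hneg hd hF hk hkc hg.1) ?_
    exact ENNReal.mul_lt_top ENNReal.ofReal_lt_top hg.2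

/-! ### `K(z, ·) ∈ L²(F)` and linearity of `T_k` -/

/-- **`∫_F K_{|k|}(z, w)² dμ(w) < ∞`**: by unfolding,
`∫_F K(z,w)² dμ(w) = 2 ∫_ℍ |k|(u(z,w)) K(w, z) dμ(w)`, a compactly supported continuous integrand.
[cite: Iwaniec2002, §2.2, PDF pp. 28–29] -/
theorem lintegral_automorphicKernel_abs_sq_lt_top (hk : IsTestKernel k) (hkc : Continuous k) (z : ℍ) :
    ∫⁻ w in F, ENNReal.ofReal (automorphicKernel Γ (fun u => |k u|) z w ^ 2) < ∞ := by
  obtain ⟨hkm, ⟨B, hB⟩, ⟨M, hM0, hM⟩⟩ := id hk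
  have hk' : IsTestKernel (fun u => |k u|) := hk.abs
  have hkc' : Continuous fun u => |k u| := continuous_abs.comp hkc
  have hM' : ∀ u, M ≤ u → (fun u => |k u|) u = 0 := fun u hu => by simp [hM u hu]
  set Ka : ℍ → ℍ → ℝ := fun z w => automorphicKernel Γ (fun u => |k u|) z w with hKa
  -- the integrand on ℍ
  set f : ℍ → ℝ := fun w => |k (pointPairInv z w)| * Ka w z with hf
  have hfc : Continuous f :=
    (hkc'.comp (continuous_pointPairInv z)).mul (continuous_automorphicKernel_left hΓ hd hk' hkc' z)
  have hf0 : ∀ w, 0 ≤ f w := fun w =>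
    mul_nonneg (abs_nonneg _) (automorphicKernel_abs_nonneg hΓ hd hk w z)
  have hfsupp : HasCompactSupport f := by
    refine HasCompactSupport.of_support_subset_isCompact (isCompact_closedBall z (2 * Real.arsinh (Real.sqrt M))) ?_
    intro w hw
    rw [Function.mem_support] at hw
    rw [Metric.mem_closedBall, dist_comm]
    by_contra h
    rw [not_le] at h
    apply hw
    simp only [hf]
    rw [kernel_eq_zero_of_dist hM h, abs_zero, zero_mul]
  have hfi : Integrable f := hfc.integrable_of_hasCompactSupport hfsupp
  set φ : ℍ → ℝ≥0∞ := fun w => ENNReal.ofReal (f w) with hφ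
  have hφm : AEMeasurable φ := (ENNReal.measurable_ofReal.comp hfc.measurable).aemeasurable
  have h := setLIntegral_tsum_smul_eq hΓ hneg hd.countable hF hφm
  have e1 : ∀ w : ℍ, ∑' γ : Γ, φ ((γ : GL (Fin 2) ℝ) • w) = ENNReal.ofReal (Ka z w ^ 2) := by
    intro w
    have ea : ∀ γ : Γ, Ka ((γ : GL (Fin 2) ℝ) • w) z = Ka w z := fun γ =>
      automorphicKernel_smul_left hΓ hd hM' γ.2 w z
    simp only [hφ, hf, ea]
    rw [← ENNReal.ofReal_tsum_of_nonneg (fun γ => mul_nonneg (abs_nonneg _)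
      (automorphicKernel_abs_nonneg hΓ hd hk w z)) ?_]
    · rw [tsum_mul_right, tsum_kernel_smul_eq_automorphicKernel hΓ hd hM' z w]
      simp only [hKa]
      rw [automorphicKernel_comm hΓ hd hM' w z, sq]
    · apply Summable.mul_right
      apply summable_of_hasFiniteSupport
      have hfin := finite_hypBall hΓ hd w z M
      refine (hfin.preimage Subtype.val_injective.injOn).subset ?_
      intro γ hγ
      simp only [Function.mem_support, ne_eq, abs_eq_zero] at hγ
      refine ⟨γ.2, ?_⟩
      by_contra hlt
      rw [not_le] at hlt
      exact hγ (hM _ (by rw [pointPairInv_comm]; exact hlt.le))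
  have e2 : ∫⁻ w in F, ∑' γ : Γ, φ ((γ : GL (Fin 2) ℝ) • w) = ∫⁻ w in F, ENNReal.ofReal (Ka z w ^ 2) :=
    lintegral_congr fun w => e1 w
  rw [← e2, h, ← ofReal_integral_eq_lintegral_ofReal hfi (Eventually.of_forall hf0)]
  exact ENNReal.mul_lt_top (by norm_num) ENNReal.ofReal_lt_top

/-- **`K(z, ·) ∈ L²(F)`** for every `z`. [cite: Iwaniec2002, §7.2, PDF p. 73] -/
theorem memLp_automorphicKernel_right (hk : IsTestKernel k) (hkc : Continuous k) (z : ℍ) :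
    MemLp (fun w => (automorphicKernel Γ k z w : ℂ)) 2 (volume.restrict F) := by
  have hmeas : AEStronglyMeasurable (fun w => (automorphicKernel Γ k z w : ℂ)) (volume.restrict F) :=
    (Complex.continuous_ofReal.comp (continuous_automorphicKernel_right hΓ hd hk hkc z)).aestronglyMeasurable
  refine ⟨hmeas, ?_⟩
  rw [eLpNorm_eq_lintegral_rpow_enorm_toReal (by norm_num) ENNReal.ofNat_ne_top]
  simp only [ENNReal.toReal_ofNat, ENNReal.rpow_two, one_div]
  refine ENNReal.rpow_lt_top_of_nonneg (by norm_num) (lt_top_iff_ne_top.mp ?_)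
  refine lt_of_le_of_lt (lintegral_mono fun w => ?_) (lintegral_automorphicKernel_abs_sq_lt_top hΓ hneg hd hF hk hkc z)
  rw [← ofReal_norm, Complex.norm_real, Real.norm_eq_abs, ← ENNReal.ofReal_pow (abs_nonneg _), sq_abs]
  refine ENNReal.ofReal_le_ofReal ?_
  have h1 := abs_automorphicKernel_le hΓ hd hk z w
  have h0 : 0 ≤ |automorphicKernel Γ k z w| := abs_nonneg _
  rw [← sq_abs (automorphicKernel Γ k z w)]
  exact pow_le_pow_left₀ h0 h1 2

/-- For `g ∈ L²(F)` the integrand `K(z, w) g(w)` is integrable on `F`. [folklore] -/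
theorem integrable_automorphicKernel_mul (hk : IsTestKernel k) (hkc : Continuous k) {g : ℍ → ℂ}
    (hg : MemLp g 2 (volume.restrict F)) (z : ℍ) :
    Integrable (fun w => (automorphicKernel Γ k z w : ℂ) * g w) (volume.restrict F) :=
  Bessel.integrable_mul (memLp_automorphicKernel_right hΓ hneg hd hF hk hkc z) hg

omit hΓ hneg hd hF in
/-- `T_k` only sees the a.e.-class of `g` on `F`. [folklore] -/
theorem kernelOp_congr_ae {g g' : ℍ → ℂ} (h : g =ᵐ[volume.restrict F] g') :
    kernelOp Γ F k g = kernelOp Γ F k g' := by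
  funext z
  simp only [kernelOp, rawKernelOp]
  congr 1
  refine integral_congr_ae ?_
  filter_upwards [h] with w hw
  rw [hw]

/-- Additivity of `T_k` on `L²(F)`. [folklore] -/
theorem kernelOp_add (hk : IsTestKernel k) (hkc : Continuous k) {f g : ℍ → ℂ}
    (hf : MemLp f 2 (volume.restrict F)) (hg : MemLp g 2 (volume.restrict F)) :
    kernelOp Γ F k (f + g) = kernelOp Γ F k f + kernelOp Γ F k g := by
  funext z
  show (1 / 2 : ℂ) * (∫ w in F, (automorphicKernel Γ k z w : ℂ) * (f + g) w) =
    (1 / 2 : ℂ) * (∫ w in F, (automorphicKernel Γ k z w : ℂ) * f w) +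
      (1 / 2 : ℂ) * (∫ w in F, (automorphicKernel Γ k z w : ℂ) * g w)
  rw [← mul_add, ← integral_add (integrable_automorphicKernel_mul hΓ hneg hd hF hk hkc hf z)
    (integrable_automorphicKernel_mul hΓ hneg hd hF hk hkc hg z)]
  congr 1
  refine integral_congr_ae (Eventually.of_forall fun w => ?_)
  simp only [Pi.add_apply]
  ring

omit hΓ hneg hd hF in
/-- Homogeneity of `T_k`. [folklore] -/
theorem kernelOp_smul (c : ℂ) (g : ℍ → ℂ) :
    kernelOp Γ F k (c • g) = c • kernelOp Γ F k g := by
  funext z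
  show (1 / 2 : ℂ) * (∫ w in F, (automorphicKernel Γ k z w : ℂ) * (c • g) w) =
    c * ((1 / 2 : ℂ) * ∫ w in F, (automorphicKernel Γ k z w : ℂ) * g w)
  have e : (∫ w in F, (automorphicKernel Γ k z w : ℂ) * (c • g) w) =
      c * ∫ w in F, (automorphicKernel Γ k z w : ℂ) * g w := by
    rw [← integral_const_mul]
    refine integral_congr_ae (Eventually.of_forall fun w => ?_)
    simp only [Pi.smul_apply, smul_eq_mul]
    ring
  rw [e]
  ring

/-- **`T_k` as a bounded operator on the Hilbert space `L²(F)`** (`‖T_k‖ ≤ C_k / 2`, Schur test).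
[cite: Iwaniec2002, §1.8 & §4.1, PDF pp. 20–21] -/
def kernelCLM (hk : IsTestKernel k) (hkc : Continuous k) :
    Lp ℂ 2 (volume.restrict F) →L[ℂ] Lp ℂ 2 (volume.restrict F) :=
  LinearMap.mkContinuous
    { toFun := fun g => (memLp_kernelOp hΓ hneg hd hF hk hkc (Lp.memLp g)).toLp (kernelOp Γ F k g)
      map_add' := by
        intro f g
        rw [← MemLp.toLp_add]
        apply MemLp.toLp_congr
        rw [kernelOp_congr_ae (Lp.coeFn_add f g), kernelOp_add hΓ hneg hd hF hk hkc (Lp.memLp f) (Lp.memLp g)]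
      map_smul' := by
        intro c g
        simp only [RingHom.id_apply]
        rw [← MemLp.toLp_const_smul]
        apply MemLp.toLp_congr
        rw [kernelOp_congr_ae (Lp.coeFn_smul c g), kernelOp_smul] }
    (schurConst k / 2)
    (by
      intro g
      simp only [LinearMap.coe_mk, AddHom.coe_mk, Lp.norm_toLp]
      rw [Lp.norm_def]
      have h := eLpNorm_kernelOp_le hΓ hneg hd hF hk hkc (Lp.memLp g).1
      have hfin : ENNReal.ofReal (schurConst k / 2) * eLpNorm g 2 (volume.restrict F) ≠ ∞ :=
        ENNReal.mul_ne_top ENNReal.ofReal_ne_top (Lp.memLp g).2.ne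
      calc (eLpNorm (kernelOp Γ F k g) 2 (volume.restrict F)).toReal
          ≤ (ENNReal.ofReal (schurConst k / 2) * eLpNorm g 2 (volume.restrict F)).toReal :=
            ENNReal.toReal_mono hfin h
        _ = schurConst k / 2 * (eLpNorm g 2 (volume.restrict F)).toReal := by
            rw [ENNReal.toReal_mul, ENNReal.toReal_ofReal]
            exact div_nonneg (schurConst_nonneg k) (by norm_num))

/-- `T_k g` is represented by the function `z ↦ ½ ∫_F K(z,w) g(w) dμ(w)`. [folklore] -/
theorem kernelCLM_coeFn (hk : IsTestKernel k) (hkc : Continuous k) (g : Lp ℂ 2 (volume.restrict F)) :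
    ⇑(kernelCLM hΓ hneg hd hF hk hkc g) =ᵐ[volume.restrict F] kernelOp Γ F k g :=
  MemLp.coeFn_toLp (memLp_kernelOp hΓ hneg hd hF hk hkc (Lp.memLp g))

/-- The operator norm bound `‖T_k‖ ≤ C_k/2`. [cite: Iwaniec2002, §1.8, PDF pp. 20–21] -/
theorem norm_kernelCLM_le (hk : IsTestKernel k) (hkc : Continuous k) :
    ‖kernelCLM hΓ hneg hd hF hk hkc‖ ≤ schurConst k / 2 :=
  LinearMap.mkContinuous_norm_le _ (div_nonneg (schurConst_nonneg k) (by norm_num)) _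

/-! ### Symmetry: `⟨T_k f, g⟩ = ⟨f, T_k g⟩` -/

omit hΓ hneg hd hF in
/-- `∫ ‖f‖² < ∞` for `f ∈ L²`. [folklore] -/
theorem lintegral_enorm_sq_lt_top {μ : Measure ℍ} {f : ℍ → ℂ} (hf : MemLp f 2 μ) :
    ∫⁻ x, ‖f x‖ₑ ^ 2 ∂μ < ∞ := by
  have h := hf.2
  rw [eLpNorm_eq_lintegral_rpow_enorm_toReal (by norm_num) ENNReal.ofNat_ne_top] at h
  simp only [ENNReal.toReal_ofNat, ENNReal.rpow_two, one_div] at h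
  by_contra hc
  rw [not_lt, top_le_iff] at hc
  rw [hc, ENNReal.top_rpow_of_pos (by norm_num)] at h
  exact lt_irrefl _ h

omit hΓ hneg hd hF in
/-- `ab ≤ a² + b²` in `ℝ≥0∞`. [folklore] -/
theorem ENNReal.mul_le_sq_add_sq (a b : ℝ≥0∞) : a * b ≤ a ^ 2 + b ^ 2 := by
  rcases le_total a b with h | h
  · calc a * b ≤ b * b := mul_le_mul_left h b
      _ = b ^ 2 := (sq b).symm
      _ ≤ a ^ 2 + b ^ 2 := le_add_self
  · calc a * b ≤ a * a := mul_le_mul_right h a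
      _ = a ^ 2 := (sq a).symm
      _ ≤ a ^ 2 + b ^ 2 := le_self_add

/-- **Absolute convergence of the double integral `∬_{F×F} K(z,w) f(w) g(z)`** for `f, g ∈ L²(F)`
(`|f(w) g(z)| ≤ |f(w)|² + |g(z)|²` and the Schur bounds). [cite: Iwaniec2002, §1.8, PDF pp. 20–21] -/
theorem integrable_kernel_prod (hk : IsTestKernel k) (hkc : Continuous k) {f g : ℍ → ℂ}
    (hf : MemLp f 2 (volume.restrict F)) (hg : MemLp g 2 (volume.restrict F)) :
    Integrable (fun p : ℍ × ℍ => (automorphicKernel Γ k p.1 p.2 : ℂ) * f p.2 * g p.1)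
      ((volume.restrict F).prod (volume.restrict F)) := by
  set μF := volume.restrict F with hμF
  have hKc : Continuous fun p : ℍ × ℍ => (automorphicKernel Γ k p.1 p.2 : ℂ) :=
    Complex.continuous_ofReal.comp (continuous_automorphicKernel₂ hΓ hd hk hkc)
  have hmeas : AEStronglyMeasurable (fun p : ℍ × ℍ => (automorphicKernel Γ k p.1 p.2 : ℂ) * f p.2 * g p.1)
      (μF.prod μF) :=
    (hKc.aestronglyMeasurable.mul hf.1.comp_snd).mul hg.1.comp_fst
  refine ⟨hmeas, ?_⟩
  -- finite integral
  set A : ℍ × ℍ → ℝ≥0∞ := fun p => ‖(automorphicKernel Γ k p.1 p.2 : ℂ)‖ₑ with hA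
  have hAm : Measurable A := hKc.measurable.enorm
  have hfm : AEMeasurable (fun p : ℍ × ℍ => ‖f p.2‖ₑ ^ 2) (μF.prod μF) := (hf.1.comp_snd.enorm).pow_const 2
  have hgm : AEMeasurable (fun p : ℍ × ℍ => ‖g p.1‖ₑ ^ 2) (μF.prod μF) := (hg.1.comp_fst.enorm).pow_const 2
  have hC := fun z => setLIntegral_enorm_automorphicKernel_le hΓ hneg hd hF hk z
  have hC' := fun w => setLIntegral_enorm_automorphicKernel_le' hΓ hneg hd hF hk w
  -- the two majorising integrals
  have hPf : AEMeasurable (fun p : ℍ × ℍ => A p * ‖f p.2‖ₑ ^ 2) (μF.prod μF) := hAm.aemeasurable.mul hfm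
  have hPg : AEMeasurable (fun p : ℍ × ℍ => A p * ‖g p.1‖ₑ ^ 2) (μF.prod μF) := hAm.aemeasurable.mul hgm
  have h1 : ∫⁻ p, A p * ‖f p.2‖ₑ ^ 2 ∂(μF.prod μF) ≤
      ENNReal.ofReal (schurConst k) * ∫⁻ w, ‖f w‖ₑ ^ 2 ∂μF := by
    rw [lintegral_prod _ hPf,
      lintegral_lintegral_swap (f := fun z w => A (z, w) * ‖f (z, w).2‖ₑ ^ 2) hPf]
    calc ∫⁻ w, ∫⁻ z, A (z, w) * ‖f (z, w).2‖ₑ ^ 2 ∂μF ∂μF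
        = ∫⁻ w, ‖f w‖ₑ ^ 2 * ∫⁻ z, A (z, w) ∂μF ∂μF := by
          refine lintegral_congr fun w => ?_
          rw [← lintegral_const_mul' _ _ (ENNReal.pow_ne_top enorm_ne_top)]
          refine lintegral_congr fun z => ?_
          rw [mul_comm]
      _ ≤ ∫⁻ w, ‖f w‖ₑ ^ 2 * ENNReal.ofReal (schurConst k) ∂μF := by
          gcongr with w; exact hC' w
      _ = ENNReal.ofReal (schurConst k) * ∫⁻ w, ‖f w‖ₑ ^ 2 ∂μF := by
          rw [lintegral_mul_const'' _ (hf.1.enorm.pow_const 2)]; ring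
  have h2 : ∫⁻ p, A p * ‖g p.1‖ₑ ^ 2 ∂(μF.prod μF) ≤
      ENNReal.ofReal (schurConst k) * ∫⁻ z, ‖g z‖ₑ ^ 2 ∂μF := by
    rw [lintegral_prod _ hPg]
    calc ∫⁻ z, ∫⁻ w, A (z, w) * ‖g (z, w).1‖ₑ ^ 2 ∂μF ∂μF
        = ∫⁻ z, ‖g z‖ₑ ^ 2 * ∫⁻ w, A (z, w) ∂μF ∂μF := by
          refine lintegral_congr fun z => ?_
          rw [← lintegral_const_mul' _ _ (ENNReal.pow_ne_top enorm_ne_top)]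
          refine lintegral_congr fun w => ?_
          rw [mul_comm]
      _ ≤ ∫⁻ z, ‖g z‖ₑ ^ 2 * ENNReal.ofReal (schurConst k) ∂μF := by
          gcongr with z; exact hC z
      _ = ENNReal.ofReal (schurConst k) * ∫⁻ z, ‖g z‖ₑ ^ 2 ∂μF := by
          rw [lintegral_mul_const'' _ (hg.1.enorm.pow_const 2)]; ring
  have hbound : ∫⁻ p, ‖(automorphicKernel Γ k p.1 p.2 : ℂ) * f p.2 * g p.1‖ₑ ∂(μF.prod μF) ≤
      ∫⁻ p, A p * ‖f p.2‖ₑ ^ 2 + A p * ‖g p.1‖ₑ ^ 2 ∂(μF.prod μF) := by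
    refine lintegral_mono fun p => ?_
    rw [enorm_mul, enorm_mul, mul_assoc, ← mul_add]
    gcongr
    exact ENNReal.mul_le_sq_add_sq _ _
  refine lt_of_le_of_lt hbound ?_
  rw [lintegral_add_left' hPf]
  refine ENNReal.add_lt_top.mpr ⟨lt_of_le_of_lt h1 ?_, lt_of_le_of_lt h2 ?_⟩
  · exact ENNReal.mul_lt_top ENNReal.ofReal_lt_top (lintegral_enorm_sq_lt_top hf)
  · exact ENNReal.mul_lt_top ENNReal.ofReal_lt_top (lintegral_enorm_sq_lt_top hg)

/-- `⟨T_k f, g⟩ = ½ ∫_F ∫_F K(z, w) conj(f(w)) g(z) dμ(w) dμ(z)`. [cite: Iwaniec2002, §1.8, PDF pp. 20–21] -/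
theorem inner_kernelCLM_left (hk : IsTestKernel k) (hkc : Continuous k) (f g : Lp ℂ 2 (volume.restrict F)) :
    @inner ℂ _ _ (kernelCLM hΓ hneg hd hF hk hkc f) g =
      (1 / 2 : ℂ) * ∫ z in F, ∫ w in F, (automorphicKernel Γ k z w : ℂ) * conj (f w) * g z := by
  rw [MeasureTheory.L2.inner_def]
  have hae := kernelCLM_coeFn hΓ hneg hd hF hk hkc f
  calc ∫ z in F, @inner ℂ _ _ ((kernelCLM hΓ hneg hd hF hk hkc f) z) (g z)
      = ∫ z in F, conj (kernelOp Γ F k f z) * g z := by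
        refine integral_congr_ae ?_
        filter_upwards [hae] with z hz
        rw [RCLike.inner_apply', hz]
    _ = ∫ z in F, (1 / 2 : ℂ) * ((∫ w in F, (automorphicKernel Γ k z w : ℂ) * conj (f w)) * g z) := by
        refine integral_congr_ae (Eventually.of_forall fun z => ?_)
        beta_reduce
        have hc : conj (1 / 2 : ℂ) = 1 / 2 := by rw [map_div₀, map_one, map_ofNat]
        have e : conj (kernelOp Γ F k f z) =
            (1 / 2 : ℂ) * ∫ w in F, (automorphicKernel Γ k z w : ℂ) * conj (f w) := by
          rw [kernelOp, rawKernelOp, map_mul, hc, ← integral_conj]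
          congr 1
          refine integral_congr_ae (Eventually.of_forall fun w => ?_)
          beta_reduce
          rw [map_mul, Complex.conj_ofReal]
        rw [e]
        ring
    _ = (1 / 2 : ℂ) * ∫ z in F, ∫ w in F, (automorphicKernel Γ k z w : ℂ) * conj (f w) * g z := by
        rw [integral_const_mul]
        congr 1
        refine integral_congr_ae (Eventually.of_forall fun z => ?_)
        beta_reduce
        rw [← integral_mul_const]

/-- `⟨f, T_k g⟩ = ½ ∫_F ∫_F K(z, w) conj(f(w)) g(z) dμ(w) dμ(z)` (Fubini and `K(z, w) = K(w, z)`).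
[cite: Iwaniec2002, §1.8, PDF pp. 20–21] -/
theorem inner_kernelCLM_right (hk : IsTestKernel k) (hkc : Continuous k) (f g : Lp ℂ 2 (volume.restrict F)) :
    @inner ℂ _ _ f (kernelCLM hΓ hneg hd hF hk hkc g) =
      (1 / 2 : ℂ) * ∫ z in F, ∫ w in F, (automorphicKernel Γ k z w : ℂ) * conj (f w) * g z := by
  obtain ⟨_, _, ⟨M, _, hM⟩⟩ := id hk
  rw [MeasureTheory.L2.inner_def]
  have hae := kernelCLM_coeFn hΓ hneg hd hF hk hkc g
  have hint := integrable_kernel_prod hΓ hneg hd hF hk hkc (Bessel.memLp_conj (Lp.memLp f)) (Lp.memLp g)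
  calc ∫ w in F, @inner ℂ _ _ (f w) ((kernelCLM hΓ hneg hd hF hk hkc g) w)
      = ∫ w in F, conj (f w) * kernelOp Γ F k g w := by
        refine integral_congr_ae ?_
        filter_upwards [hae] with w hw
        rw [RCLike.inner_apply', hw]
    _ = ∫ w in F, (1 / 2 : ℂ) * ∫ z in F, (automorphicKernel Γ k z w : ℂ) * conj (f w) * g z := by
        refine integral_congr_ae (Eventually.of_forall fun w => ?_)
        beta_reduce
        rw [kernelOp, rawKernelOp, ← mul_assoc, mul_comm (conj (f w)), mul_assoc, ← integral_const_mul]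
        congr 1
        refine integral_congr_ae (Eventually.of_forall fun z => ?_)
        beta_reduce
        rw [automorphicKernel_comm hΓ hd hM w z]
        ring
    _ = (1 / 2 : ℂ) * ∫ w in F, ∫ z in F, (automorphicKernel Γ k z w : ℂ) * conj (f w) * g z := by
        rw [integral_const_mul]
    _ = (1 / 2 : ℂ) * ∫ z in F, ∫ w in F, (automorphicKernel Γ k z w : ℂ) * conj (f w) * g z := by
        congr 1
        exact (integral_integral_swap hint).symm

/-- **`T_k` is self-adjoint** on `L²(F)` (`K` real and symmetric; Iwaniec §4.1: the invariant
integral operators with real `k` are symmetric). [cite: Iwaniec2002, §1.8 & §4.1, PDF pp. 20–21] -/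
theorem isSelfAdjoint_kernelCLM (hk : IsTestKernel k) (hkc : Continuous k) :
    IsSelfAdjoint (kernelCLM hΓ hneg hd hF hk hkc) := by
  apply LinearMap.IsSymmetric.isSelfAdjoint
  intro f g
  change @inner ℂ _ _ (kernelCLM hΓ hneg hd hF hk hkc f) g = @inner ℂ _ _ f (kernelCLM hΓ hneg hd hF hk hkc g)
  rw [inner_kernelCLM_left, inner_kernelCLM_right]

/-- Symmetry as an operator identity. [cite: Iwaniec2002, §1.8 & §4.1, PDF pp. 20–21] -/
theorem kernelCLM_isSymmetric (hk : IsTestKernel k) (hkc : Continuous k) :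
    (kernelCLM hΓ hneg hd hF hk hkc : Lp ℂ 2 (volume.restrict F) →ₗ[ℂ] Lp ℂ 2 (volume.restrict F)).IsSymmetric :=
  (isSelfAdjoint_kernelCLM hΓ hneg hd hF hk hkc).isSymmetric

/-! ### Eigenfunctions: `T_k u = h(t) u`, `T_k 1 = h(i/2) 1` -/

/-- For automorphic locally integrable `g`, `T_k g = L_k g` pointwise (unfolding).
[cite: Iwaniec2002, §7.4, PDF p. 76] -/
theorem kernelOp_eq_invariantOperator_of_automorphic (hk : IsTestKernel k) {g : ℍ → ℂ}
    (hga : IsAutomorphic Γ g) (hgi : LocallyIntegrable g) (z : ℍ) :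
    kernelOp Γ F k g z = invariantOperator k g z := by
  rw [kernelOp, rawKernelOp, setIntegral_automorphicKernel_mul hΓ hneg hd hF hk hga hgi z]
  ring

/-- **Theorem 1.16 on `L²(Γ\ℍ)`**: an automorphic `C²` eigenfunction `u`, `(Δ + 1/4 + t²)u = 0`, is an
eigenfunction of every `T_k` with eigenvalue the Selberg/Harish-Chandra transform `h(t)`:
`T_k u = h(t) u` pointwise. [cite: Iwaniec2002, Thm 1.16 & Thm 7.4 (proof), PDF pp. 24, 76] -/
theorem kernelOp_eigenfunction (hk : IsTestKernel k) {u : ℍ → ℂ} (hua : IsAutomorphic Γ u) (huc : IsC2 u)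
    (t : ℂ) (heig : ∀ z, hypLaplacian u z + (1 / 4 + t ^ 2) * u z = 0) (z : ℍ) :
    kernelOp Γ F k u z = selbergTransform k t * u z := by
  rw [kernelOp, rawKernelOp, setIntegral_automorphicKernel_mul_eigenfunction hΓ hneg hd hF hk hua huc t heig z]
  ring

/-- Constants: `T_k c = (4π ∫_0^∞ k) c = h(i/2) c`. [cite: Iwaniec2002, §7.2, PDF p. 73] -/
theorem kernelOp_const (hk : IsTestKernel k) (c : ℂ) (z : ℍ) :
    kernelOp Γ F k (fun _ => c) z = ((4 * π * ∫ u in Ioi 0, k u : ℝ) : ℂ) * c := by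
  rw [kernelOp_eq_invariantOperator_of_automorphic hΓ hneg hd hF hk (isAutomorphic_const Γ c)
    (locallyIntegrable_const c) z, invariantOperator_const hk c z]

/-- **Eigenvectors of `T_k` in `L²(F)`**: an automorphic `C²` eigenfunction `u ∈ L²(F)` with
`(Δ + 1/4 + t²)u = 0` satisfies `T_k [u] = h(t) [u]` in `L²(F)`.
[cite: Iwaniec2002, Thm 1.16 & §4.1, PDF pp. 24] -/
theorem kernelCLM_toLp_eigenfunction (hk : IsTestKernel k) (hkc : Continuous k) {u : ℍ → ℂ}
    (hua : IsAutomorphic Γ u) (huc : IsC2 u) (t : ℂ)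
    (heig : ∀ z, hypLaplacian u z + (1 / 4 + t ^ 2) * u z = 0) (hu2 : MemLp u 2 (volume.restrict F)) :
    kernelCLM hΓ hneg hd hF hk hkc (hu2.toLp u) = selbergTransform k t • hu2.toLp u := by
  have h1 := kernelCLM_coeFn hΓ hneg hd hF hk hkc (hu2.toLp u)
  have h2 : kernelOp Γ F k (⇑(hu2.toLp u)) = kernelOp Γ F k u := kernelOp_congr_ae (MemLp.coeFn_toLp hu2)
  have h3 : kernelOp Γ F k u = fun z => selbergTransform k t * u z :=
    funext (kernelOp_eigenfunction hΓ hneg hd hF hk hua huc t heig)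
  refine Lp.ext ?_
  filter_upwards [h1, Lp.coeFn_smul (selbergTransform k t) (hu2.toLp u), MemLp.coeFn_toLp hu2] with z hz hs hu
  rw [hz, h2, h3, hs, Pi.smul_apply, hu, smul_eq_mul]

/-- Constants in `L²(F)` (finite covolume): `T_k [c] = (4π∫k) [c]`. [cite: Iwaniec2002, §7.2, PDF p. 73] -/
theorem kernelCLM_toLp_const (hk : IsTestKernel k) (hkc : Continuous k) (c : ℂ)
    (hc2 : MemLp (fun _ : ℍ => c) 2 (volume.restrict F)) :
    kernelCLM hΓ hneg hd hF hk hkc (hc2.toLp (fun _ => c)) =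
      (((4 * π * ∫ u in Ioi 0, k u : ℝ) : ℂ)) • hc2.toLp (fun _ => c) := by
  have h1 := kernelCLM_coeFn hΓ hneg hd hF hk hkc (hc2.toLp (fun _ => c))
  have h2 : kernelOp Γ F k (⇑(hc2.toLp (fun _ => c))) = kernelOp Γ F k (fun _ => c) :=
    kernelOp_congr_ae (MemLp.coeFn_toLp hc2)
  have h3 : kernelOp Γ F k (fun _ => c) = fun _ => ((4 * π * ∫ u in Ioi 0, k u : ℝ) : ℂ) * c :=
    funext (kernelOp_const hΓ hneg hd hF hk c)
  refine Lp.ext ?_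
  filter_upwards [h1, Lp.coeFn_smul (((4 * π * ∫ u in Ioi 0, k u : ℝ) : ℂ)) (hc2.toLp (fun _ => c)),
    MemLp.coeFn_toLp hc2] with z hz hs hu
  rw [hz, h2, h3, hs, Pi.smul_apply, hu, smul_eq_mul]

end Operator

/-! ## 4. The automorphic extension of a function on `F` -/

section Extension

variable {Γ : Subgroup (GL (Fin 2) ℝ)} {F : Set ℍ}

/-- **Automorphic extension** of `g : F → ℂ` (given as a function on `ℍ`, values off `F` ignored):
`g^Γ(z) = ½ Σ_{γ ∈ Γ} (𝟙_F g)(γ z)`. For a.e. `z` exactly the two matrices `±γ₀` with `γ₀ z ∈ F`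
contribute, so `g^Γ(z) = g(γ₀ z)`; `g^Γ` is exactly `Γ`-invariant and agrees with `g` a.e. on `F`.
(Iwaniec identifies functions on `Γ\ℍ`, on `F`, and automorphic functions on `ℍ`, §2.2–§4.1.)
[cite: Iwaniec2002, §2.2, PDF pp. 28–29] -/
def autExt (Γ : Subgroup (GL (Fin 2) ℝ)) (F : Set ℍ) (g : ℍ → ℂ) (z : ℍ) : ℂ :=
  (1 / 2 : ℂ) * ∑' γ : Γ, F.indicator g ((γ : GL (Fin 2) ℝ) • z)

/-- `g^Γ(γ₀ z) = g^Γ(z)` (reindex the sum). [folklore] -/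
theorem autExt_smul {γ₀ : GL (Fin 2) ℝ} (hγ₀ : γ₀ ∈ Γ) (g : ℍ → ℂ) (z : ℍ) :
    autExt Γ F g (γ₀ • z) = autExt Γ F g z := by
  unfold autExt
  congr 1
  simp_rw [← mul_smul]
  exact (Equiv.mulRight (⟨γ₀, hγ₀⟩ : Γ)).tsum_eq (fun γ : Γ => F.indicator g ((γ : GL (Fin 2) ℝ) • z))

/-- The extension is automorphic. [cite: Iwaniec2002, §3.1, PDF p. 40] -/
theorem isAutomorphic_autExt (g : ℍ → ℂ) : IsAutomorphic Γ (autExt Γ F g) :=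
  fun _ hγ z => autExt_smul hγ g z

/-- On an orbit meeting `F` exactly in `±γ₀ w`: `g^Γ(w) = g(γ₀ w)`. [folklore] -/
theorem autExt_eq_of_orbit (g : ℍ → ℂ) {w : ℍ} {γ₀ : GL (Fin 2) ℝ} (hne : γ₀ ≠ -γ₀)
    (hset : {γ : GL (Fin 2) ℝ | γ ∈ Γ ∧ γ • w ∈ F} = {γ₀, -γ₀}) :
    autExt Γ F g w = g (γ₀ • w) := by
  classical
  have hmem : ∀ γ : GL (Fin 2) ℝ, (γ ∈ Γ ∧ γ • w ∈ F) ↔ (γ = γ₀ ∨ γ = -γ₀) := fun γ => by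
    have := Set.ext_iff.mp hset γ
    simpa using this
  have h0 : γ₀ ∈ Γ ∧ γ₀ • w ∈ F := (hmem γ₀).mpr (Or.inl rfl)
  have h1 : -γ₀ ∈ Γ ∧ (-γ₀) • w ∈ F := (hmem (-γ₀)).mpr (Or.inr rfl)
  set S : Finset Γ := {⟨γ₀, h0.1⟩, ⟨-γ₀, h1.1⟩} with hS
  have hsupp : ∀ γ : Γ, γ ∉ S → F.indicator g ((γ : GL (Fin 2) ℝ) • w) = 0 := by
    intro γ hγ
    rw [Set.indicator_of_notMem]
    intro hwF
    rcases (hmem γ).mp ⟨γ.2, hwF⟩ with h | h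
    · exact hγ (by rw [hS, Finset.mem_insert]; left; exact Subtype.ext h)
    · exact hγ (by rw [hS, Finset.mem_insert, Finset.mem_singleton]; right; exact Subtype.ext h)
  have hne' : (⟨γ₀, h0.1⟩ : Γ) ≠ ⟨-γ₀, h1.1⟩ := fun h => hne (congrArg Subtype.val h)
  unfold autExt
  rw [tsum_eq_sum hsupp, hS, Finset.sum_pair hne']
  simp only
  rw [Set.indicator_of_mem h0.2, Set.indicator_of_mem h1.2, neg_smul_eq]
  ring

variable (hΓ : Γ ≤ (Matrix.SpecialLinearGroup.toGL : SL(2, ℝ) →* GL (Fin 2) ℝ).range)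
  (hneg : (-1 : GL (Fin 2) ℝ) ∈ Γ) (hd : IsDiscreteSubgroup Γ) (hF : IsHypFundamentalDomain Γ F)
include hΓ hneg hd hF

/-- For a.e. `w ∈ ℍ`: `g^Γ(w) = g(γ₀ w)` for some `γ₀ ∈ Γ` with `γ₀ w ∈ F`, and the family
`γ ↦ (𝟙_F g)(γ w)` vanishes off `{±γ₀}`. [cite: Iwaniec2002, §2.2, PDF pp. 28–29] -/
theorem ae_autExt_eq_smul (g : ℍ → ℂ) :
    ∀ᵐ w : ℍ, ∃ γ₀ ∈ Γ, γ₀ • w ∈ F ∧ autExt Γ F g w = g (γ₀ • w) ∧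
      {γ : GL (Fin 2) ℝ | γ ∈ Γ ∧ γ • w ∈ F} = {γ₀, -γ₀} := by
  filter_upwards [ae_orbit_meets_two hΓ hneg hd.countable hF] with w hw
  obtain ⟨γ₀, hγ₀, hne, hset⟩ := hw
  have h0 : γ₀ • w ∈ F := by
    have : γ₀ ∈ ({γ₀, -γ₀} : Set (GL (Fin 2) ℝ)) := by simp
    rw [← hset] at this
    exact this.2
  exact ⟨γ₀, hγ₀, h0, autExt_eq_of_orbit g hne hset, hset⟩

/-- **`g^Γ = g` a.e. on `F`.** [cite: Iwaniec2002, §2.2, PDF pp. 28–29] -/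
theorem ae_autExt_eq (g : ℍ → ℂ) : ∀ᵐ w : ℍ, w ∈ F → autExt Γ F g w = g w := by
  filter_upwards [ae_autExt_eq_smul hΓ hneg hd hF g] with w hw hwF
  obtain ⟨γ₀, hγ₀, _, heq, hset⟩ := hw
  have h1 : (1 : GL (Fin 2) ℝ) ∈ ({γ₀, -γ₀} : Set (GL (Fin 2) ℝ)) := by
    rw [← hset]; exact ⟨Γ.one_mem, by rw [one_smul]; exact hwF⟩
  rw [heq]
  rcases h1 with h | h
  · rw [← h, one_smul]
  · rw [show γ₀ = -1 by rw [← neg_neg γ₀, ← h], neg_smul_eq, one_smul]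

/-- `g^Γ = g` in `L⁰(F)`: a.e. for the restricted measure. [cite: Iwaniec2002, §2.2, PDF pp. 28–29] -/
theorem autExt_ae_eq_restrict (g : ℍ → ℂ) : autExt Γ F g =ᵐ[volume.restrict F] g :=
  (ae_restrict_iff' hF.measurableSet).mpr (ae_autExt_eq hΓ hneg hd hF g)

/-- The extension only depends on the a.e.-class of `g` on `F` (up to a null set of `ℍ`). [folklore] -/
theorem autExt_congr_ae {g g' : ℍ → ℂ} (h : g =ᵐ[volume.restrict F] g') :
    autExt Γ F g =ᵐ[volume] autExt Γ F g' := by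
  -- the null set where `g ≠ g'` inside `F`, and its translates
  set N : Set ℍ := {v : ℍ | v ∈ F ∧ g v ≠ g' v} with hN
  have hN0 : volume N = 0 := by
    have h1 : ∀ᵐ v : ℍ, v ∈ F → g v = g' v := (ae_restrict_iff' hF.measurableSet).mp h
    rw [ae_iff] at h1
    refine measure_mono_null (fun v hv => ?_) h1
    simp only [Set.mem_setOf_eq, Classical.not_imp]
    exact ⟨hv.1, hv.2⟩
  have hc := hd.countable
  have hall : ∀ᵐ w : ℍ, ∀ γ ∈ Γ, γ • w ∉ N := by
    have : {w : ℍ | ¬ ∀ γ ∈ Γ, γ • w ∉ N} ⊆ ⋃ γ ∈ (Γ : Set (GL (Fin 2) ℝ)), (fun w : ℍ => γ • w) ⁻¹' N := by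
      intro w hw
      simp only [Set.mem_setOf_eq, not_forall, not_not, exists_prop] at hw
      obtain ⟨γ, hγ, hγN⟩ := hw
      exact Set.mem_biUnion hγ hγN
    rw [ae_iff]
    refine measure_mono_null this ((measure_biUnion_null_iff hc).mpr fun γ _ => ?_)
    rw [MeasureTheory.measure_preimage_smul]
    exact hN0
  filter_upwards [ae_autExt_eq_smul hΓ hneg hd hF g, ae_autExt_eq_smul hΓ hneg hd hF g', hall] with w hw hw' hwN
  obtain ⟨γ₀, hγ₀, hγ₀F, heq, hset⟩ := hw
  obtain ⟨γ₁, hγ₁, hγ₁F, heq', hset'⟩ := hw'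
  -- `γ₁ = ±γ₀`, so `γ₁ w = γ₀ w`
  have h1 : γ₁ ∈ ({γ₀, -γ₀} : Set (GL (Fin 2) ℝ)) := by rw [← hset]; exact ⟨hγ₁, hγ₁F⟩
  have e1 : γ₁ • w = γ₀ • w := by
    rcases h1 with h | h
    · rw [h]
    · rw [h, neg_smul_eq]
  rw [heq, heq', e1]
  by_contra hne
  exact hwN γ₀ hγ₀ ⟨hγ₀F, hne⟩

omit hΓ hneg hd in
/-- Each term `w ↦ (𝟙_F g)(γ w)` is a.e.-strongly measurable on `ℍ`. [folklore] -/
theorem aestronglyMeasurable_indicator_smul {g : ℍ → ℂ} (hg : AEStronglyMeasurable g (volume.restrict F))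
    (γ : GL (Fin 2) ℝ) : AEStronglyMeasurable (fun w : ℍ => F.indicator g (γ • w)) volume :=
  ((aestronglyMeasurable_indicator_iff hF.measurableSet).mpr hg).comp_measurePreserving
    (measurePreserving_smul γ (volume : Measure ℍ))

/-- **The extension is a.e.-strongly measurable on `ℍ`** (a.e. limit of the finite partial sums).
[folklore] -/
theorem aestronglyMeasurable_autExt {g : ℍ → ℂ} (hg : AEStronglyMeasurable g (volume.restrict F)) :
    AEStronglyMeasurable (autExt Γ F g) volume := by
  haveI : Countable Γ := hd.countable.to_subtype
  classical
  have hterm : ∀ γ : Γ, AEStronglyMeasurable (fun w : ℍ => F.indicator g ((γ : GL (Fin 2) ℝ) • w)) volume :=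
    fun γ => aestronglyMeasurable_indicator_smul hF hg (γ : GL (Fin 2) ℝ)
  have htm : ∀ s : Finset Γ, AEStronglyMeasurable
      (fun w : ℍ => (1 / 2 : ℂ) * ∑ γ ∈ s, F.indicator g ((γ : GL (Fin 2) ℝ) • w)) volume := by
    intro s
    have h1 : AEStronglyMeasurable (fun w : ℍ => ∑ γ ∈ s, F.indicator g ((γ : GL (Fin 2) ℝ) • w)) volume :=
      Finset.aestronglyMeasurable_fun_sum s fun γ _ => hterm γ
    exact h1.const_mul (1 / 2 : ℂ)
  refine aestronglyMeasurable_of_tendsto_ae (atTop : Filter (Finset Γ)) htm ?_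
  filter_upwards [ae_autExt_eq_smul hΓ hneg hd hF g] with w hw
  obtain ⟨γ₀, hγ₀, hγ₀F, heq, hset⟩ := hw
  -- the family vanishes off the finite set `{±γ₀}`
  have hmem : ∀ γ : GL (Fin 2) ℝ, (γ ∈ Γ ∧ γ • w ∈ F) ↔ (γ = γ₀ ∨ γ = -γ₀) := fun γ => by
    have := Set.ext_iff.mp hset γ
    simpa using this
  have h1 : -γ₀ ∈ Γ := ((hmem (-γ₀)).mpr (Or.inr rfl)).1
  set S : Finset Γ := {⟨γ₀, hγ₀⟩, ⟨-γ₀, h1⟩} with hS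
  have hsupp : ∀ γ : Γ, γ ∉ S → F.indicator g ((γ : GL (Fin 2) ℝ) • w) = 0 := by
    intro γ hγ
    rw [Set.indicator_of_notMem]
    intro hwF
    rcases (hmem γ).mp ⟨γ.2, hwF⟩ with h | h
    · exact hγ (by rw [hS, Finset.mem_insert]; left; exact Subtype.ext h)
    · exact hγ (by rw [hS, Finset.mem_insert, Finset.mem_singleton]; right; exact Subtype.ext h)
  have hsum := hasSum_sum_of_ne_finset_zero (L := SummationFilter.unconditional Γ) hsupp
  have htend : Tendsto (fun s : Finset Γ => ∑ γ ∈ s, F.indicator g ((γ : GL (Fin 2) ℝ) • w)) atTop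
      (𝓝 (∑ γ ∈ S, F.indicator g ((γ : GL (Fin 2) ℝ) • w))) := hsum
  have e : autExt Γ F g w = (1 / 2 : ℂ) * ∑ γ ∈ S, F.indicator g ((γ : GL (Fin 2) ℝ) • w) := by
    unfold autExt
    rw [tsum_eq_sum hsupp]
  rw [e]
  have h2 : Tendsto (fun s : Finset Γ => (1 / 2 : ℂ) * ∑ γ ∈ s, F.indicator g ((γ : GL (Fin 2) ℝ) • w))
      atTop (𝓝 ((1 / 2 : ℂ) * ∑ γ ∈ S, F.indicator g ((γ : GL (Fin 2) ℝ) • w))) :=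
    htend.const_mul (1 / 2 : ℂ)
  exact h2

/-! ### Local square-integrability of the extension and `T_k g = L_k g^Γ` -/

omit hneg hd hF in
/-- **Uniform bound for the number of orbit points in a compact set**: for `C ⊆ B(z₀, D)` and every
`w ∈ ℍ`, `Σ_{γ ∈ Γ} 𝟙_C(γ w) ≤ N_C := Σ_{δ ∈ Γ} 𝟙(ρ(δ z₀, z₀) ≤ 2D)` (if `γ₁ w ∈ C`, the map
`γ ↦ γ γ₁⁻¹` sends `{γ : γ w ∈ C}` into `{δ : ρ(δ z₀, z₀) ≤ 2D}`), and `N_C < ∞` by discreteness.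
[cite: Iwaniec2002, §2.1, PDF pp. 27–28] -/
theorem tsum_indicator_smul_le {C : Set ℍ} {z₀ : ℍ} {D : ℝ} (hC : C ⊆ Metric.closedBall z₀ D) (w : ℍ) :
    ∑' γ : Γ, C.indicator (fun _ => (1 : ℝ≥0∞)) ((γ : GL (Fin 2) ℝ) • w) ≤
      ∑' δ : Γ, {δ : Γ | dist ((δ : GL (Fin 2) ℝ) • z₀) z₀ ≤ 2 * D}.indicator (fun _ => (1 : ℝ≥0∞)) δ := by
  by_cases h : ∃ γ₁ : Γ, (γ₁ : GL (Fin 2) ℝ) • w ∈ C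
  · obtain ⟨γ₁, hγ₁⟩ := h
    rw [← (Equiv.mulRight γ₁).tsum_eq (fun γ : Γ => C.indicator (fun _ => (1 : ℝ≥0∞)) ((γ : GL (Fin 2) ℝ) • w))]
    refine ENNReal.tsum_le_tsum fun δ => ?_
    simp only [Equiv.coe_mulRight, Subgroup.coe_mul, mul_smul]
    by_cases hδ : ((δ : GL (Fin 2) ℝ) • ((γ₁ : GL (Fin 2) ℝ) • w)) ∈ C
    · rw [Set.indicator_of_mem hδ, Set.indicator_of_mem]
      simp only [Set.mem_setOf_eq]
      obtain ⟨g, hg⟩ := hΓ δ.2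
      have e : ∀ x : ℍ, (δ : GL (Fin 2) ℝ) • x = g • x := fun x => by rw [← hg]; rfl
      have h1 : dist ((γ₁ : GL (Fin 2) ℝ) • w) z₀ ≤ D := hC hγ₁
      have h2 : dist ((δ : GL (Fin 2) ℝ) • ((γ₁ : GL (Fin 2) ℝ) • w)) z₀ ≤ D := hC hδ
      rw [e] at h2 ⊢
      calc dist (g • z₀) z₀ ≤ dist (g • z₀) (g • ((γ₁ : GL (Fin 2) ℝ) • w)) +
            dist (g • ((γ₁ : GL (Fin 2) ℝ) • w)) z₀ := dist_triangle _ _ _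
        _ = dist z₀ ((γ₁ : GL (Fin 2) ℝ) • w) + dist (g • ((γ₁ : GL (Fin 2) ℝ) • w)) z₀ := by rw [dist_smul]
        _ ≤ D + D := by rw [dist_comm]; exact add_le_add h1 h2
        _ = 2 * D := by ring
    · rw [Set.indicator_of_notMem hδ]
      exact zero_le
  · push Not at h
    have e : ∀ γ : Γ, C.indicator (fun _ => (1 : ℝ≥0∞)) ((γ : GL (Fin 2) ℝ) • w) = 0 := fun γ =>
      Set.indicator_of_notMem (h γ) _
    simp only [e, tsum_zero]
    exact zero_le

omit hneg hF in
/-- The orbit-count bound `N_C` is finite. [cite: Iwaniec2002, §2.1, PDF pp. 27–28] -/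
theorem tsum_indicator_dist_le_lt_top (z₀ : ℍ) (D : ℝ) :
    ∑' δ : Γ, {δ : Γ | dist ((δ : GL (Fin 2) ℝ) • z₀) z₀ ≤ D}.indicator (fun _ => (1 : ℝ≥0∞)) δ < ∞ := by
  have hfin : {δ : Γ | dist ((δ : GL (Fin 2) ℝ) • z₀) z₀ ≤ D}.Finite :=
    ((finite_dist_le hΓ hd z₀ z₀ D).preimage Subtype.val_injective.injOn).subset
      fun δ hδ => ⟨δ.2, hδ⟩
  classical
  rw [tsum_eq_sum (s := hfin.toFinset) (fun δ hδ => Set.indicator_of_notMem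
    (fun h => hδ (hfin.mem_toFinset.mpr h)) _)]
  refine ENNReal.sum_lt_top.mpr fun δ _ => ?_
  by_cases h : δ ∈ {δ : Γ | dist ((δ : GL (Fin 2) ℝ) • z₀) z₀ ≤ D}
  · rw [Set.indicator_of_mem h]; exact ENNReal.one_lt_top
  · rw [Set.indicator_of_notMem h]; exact ENNReal.zero_lt_top

/-- **`g^Γ ∈ L²_loc(ℍ)` for `g ∈ L²(F)`**: `2 ∫_C |g^Γ|² ≤ N_C ∫_F |g|²` for compact `C ⊆ B(z₀, D)`
(unfolding and the orbit-count bound). [cite: Iwaniec2002, §2.2, PDF pp. 28–29] -/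
theorem lintegral_enorm_sq_autExt_le {C : Set ℍ} (hCm : MeasurableSet C) {z₀ : ℍ} {D : ℝ}
    (hC : C ⊆ Metric.closedBall z₀ D) {g : ℍ → ℂ} (hg : AEStronglyMeasurable g (volume.restrict F)) :
    2 * ∫⁻ w in C, ‖autExt Γ F g w‖ₑ ^ 2 ≤
      (∑' δ : Γ, {δ : Γ | dist ((δ : GL (Fin 2) ℝ) • z₀) z₀ ≤ 2 * D}.indicator (fun _ => (1 : ℝ≥0∞)) δ) *
        ∫⁻ w in F, ‖g w‖ₑ ^ 2 := by
  set N : ℝ≥0∞ := ∑' δ : Γ, {δ : Γ | dist ((δ : GL (Fin 2) ℝ) • z₀) z₀ ≤ 2 * D}.indicator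
    (fun _ => (1 : ℝ≥0∞)) δ with hN
  set φ : ℍ → ℝ≥0∞ := C.indicator (fun w => ‖autExt Γ F g w‖ₑ ^ 2) with hφ
  have hgm : AEMeasurable (fun w => ‖autExt Γ F g w‖ₑ ^ 2) volume :=
    ((aestronglyMeasurable_autExt hΓ hneg hd hF hg).enorm).pow_const 2
  have hφm : AEMeasurable φ volume := hgm.indicator hCm
  have h := setLIntegral_tsum_smul_eq hΓ hneg hd.countable hF hφm
  rw [lintegral_indicator hCm] at h
  rw [← h]
  -- bound the sum pointwise
  have hpt : ∀ w, ∑' γ : Γ, φ ((γ : GL (Fin 2) ℝ) • w) ≤ N * ‖autExt Γ F g w‖ₑ ^ 2 := by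
    intro w
    have e : ∀ γ : Γ, φ ((γ : GL (Fin 2) ℝ) • w) =
        C.indicator (fun _ => (1 : ℝ≥0∞)) ((γ : GL (Fin 2) ℝ) • w) * ‖autExt Γ F g w‖ₑ ^ 2 := by
      intro γ
      simp only [hφ]
      by_cases hγ : ((γ : GL (Fin 2) ℝ) • w) ∈ C
      · rw [Set.indicator_of_mem hγ, Set.indicator_of_mem hγ, one_mul, autExt_smul γ.2]
      · rw [Set.indicator_of_notMem hγ, Set.indicator_of_notMem hγ, zero_mul]
    simp_rw [e]
    rw [ENNReal.tsum_mul_right]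
    gcongr
    exact tsum_indicator_smul_le hΓ hC w
  calc ∫⁻ w in F, ∑' γ : Γ, φ ((γ : GL (Fin 2) ℝ) • w)
      ≤ ∫⁻ w in F, N * ‖autExt Γ F g w‖ₑ ^ 2 := lintegral_mono hpt
    _ = N * ∫⁻ w in F, ‖autExt Γ F g w‖ₑ ^ 2 := by
        rw [lintegral_const_mul'' _ (hgm.restrict)]
    _ = N * ∫⁻ w in F, ‖g w‖ₑ ^ 2 := by
        congr 1
        refine lintegral_congr_ae ?_
        filter_upwards [autExt_ae_eq_restrict hΓ hneg hd hF g] with w hw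
        rw [hw]

/-- **`g^Γ` is locally integrable on `ℍ`** for `g ∈ L²(F)`. [cite: Iwaniec2002, §2.2, PDF pp. 28–29] -/
theorem locallyIntegrable_autExt {g : ℍ → ℂ} (hg : MemLp g 2 (volume.restrict F)) :
    LocallyIntegrable (autExt Γ F g) := by
  rw [locallyIntegrable_iff]
  intro C hC
  obtain ⟨D, hD⟩ := hC.isBounded.subset_closedBall UpperHalfPlane.I
  have hmeas : AEStronglyMeasurable (autExt Γ F g) (volume.restrict C) :=
    (aestronglyMeasurable_autExt hΓ hneg hd hF hg.1).restrict
  haveI : IsFiniteMeasure (volume.restrict C) :=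
    ⟨by rw [Measure.restrict_apply_univ]; exact hC.measure_lt_top⟩
  refine MemLp.integrable one_le_two ⟨hmeas, ?_⟩
  rw [eLpNorm_eq_lintegral_rpow_enorm_toReal (by norm_num) ENNReal.ofNat_ne_top]
  simp only [ENNReal.toReal_ofNat, ENNReal.rpow_two, one_div]
  refine ENNReal.rpow_lt_top_of_nonneg (by norm_num) (lt_top_iff_ne_top.mp ?_)
  have h := lintegral_enorm_sq_autExt_le hΓ hneg hd hF hC.measurableSet hD hg.1
  have hN := tsum_indicator_dist_le_lt_top hΓ hd UpperHalfPlane.I (2 * D)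
  have hfin : (∑' δ : Γ, {δ : Γ | dist ((δ : GL (Fin 2) ℝ) • UpperHalfPlane.I) UpperHalfPlane.I ≤ 2 * D}.indicator
      (fun _ => (1 : ℝ≥0∞)) δ) * ∫⁻ w in F, ‖g w‖ₑ ^ 2 < ∞ :=
    ENNReal.mul_lt_top hN (lintegral_enorm_sq_lt_top hg)
  have h2 : ∫⁻ w in C, ‖autExt Γ F g w‖ₑ ^ 2 ≤ 2 * ∫⁻ w in C, ‖autExt Γ F g w‖ₑ ^ 2 := by
    conv_lhs => rw [← one_mul (∫⁻ w in C, ‖autExt Γ F g w‖ₑ ^ 2)]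
    gcongr
    norm_num
  exact lt_of_le_of_lt (h2.trans h) hfin

/-- **`T_k g = L_k g^Γ`**: the operator on `L²(F)` is the invariant integral operator applied to the
automorphic extension, `½ ∫_F K(z,w) g(w) dμ(w) = ∫_ℍ k(u(z,w)) g^Γ(w) dμ(w)` for all `z`.
[cite: Iwaniec2002, §7.4, PDF p. 76] -/
theorem kernelOp_eq_invariantOperator {k : ℝ → ℝ} (hk : IsTestKernel k) {g : ℍ → ℂ}
    (hg : MemLp g 2 (volume.restrict F)) (z : ℍ) :
    kernelOp Γ F k g z = invariantOperator k (autExt Γ F g) z := by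
  rw [← kernelOp_eq_invariantOperator_of_automorphic hΓ hneg hd hF hk (isAutomorphic_autExt g)
    (locallyIntegrable_autExt hΓ hneg hd hF hg) z]
  exact congrFun (kernelOp_congr_ae (autExt_ae_eq_restrict hΓ hneg hd hF g).symm) z

end Extension

end Literature.NumberTheory.Automorphic
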